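import Summits.NavierStokesRegularity.NavierStokesRegularity.Theses.AxisymmetricExtremality
import Summits.NavierStokesRegularity.NavierStokesRegularity.Theorems.AxisymmetricExtremalityAxisymmetricKatoGlobalStubSereginLogSwirlOriginCoreAtOriginBridges
import Summits.NavierStokesRegularity.NavierStokesRegularity.Theorems.AxisymmetricExtremalityAxisymmetricKatoGlobalStubSereginLogSwirlOriginCoreNormalise
import Summits.NavierStokesRegularity.NavierStokesRegularity.Theorems.AxisymmetricExtremalityAxisymmetricKatoGlobalStubSereginLogSwirlOriginStep3LocalKeyEstimateSZ
import HarnessLib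

/-!
# Crux `AxisymmetricKatoGlobal` (stmt-NavierStokesRegularity-15453), line `registered`, stub 2a
# `stub_sereginLogSwirlOrigin`: Seregin's logarithmic swirl criterion at the origin (J. Math.
# Fluid Mech. 24 (2022), §2) fully assembled — discharges the named fact
# `Literature.Analysis.FluidPDE.seregin2022_logSwirl_regularAtOrigin`

Stub file (`--supports stmt-NavierStokesRegularity-15453`; theorems only, everything proved) of
the registered stub `stub_sereginLogSwirlOrigin` of the union skeleton
`Cruxes/AxisymmetricKatoGlobal/Lines/euler_scaling.lean`, whose statement is VERBATIM the named
fact `Literature.Analysis.FluidPDE.seregin2022_logSwirl_regularAtOrigin` (G. Seregin, *A note on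
local regularity of axisymmetric solutions to the Navier–Stokes equations*, J. Math. Fluid Mech.
24 (2022), Paper 27 = arXiv:2201.00153, §2: a suitable weak solution of the unit-viscosity system
in `Q = 𝒞 × ]-1, 0[` in the classes of Def. 1.1 with axisymmetric slices and the swirl bound
(2.2) `|σ| ≤ C₁/ln³(e/|x'|)` has the origin as a regular point).

The discharge was assembled over this session's waves (all in this namespace, files
`…StubSereginLogSwirlOrigin<X>.lean`): Step 1 (first singular time, top-time partial regularity,
clean slab, Seregin–Zajaczkowski representative: `…TopTimePartialRegularity` p156541,
`…ParabolicNullLines` p155244, `…FirstSingular` p167588, `…CleanSlabRepr` p167975,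
`…FinalReduction` p168224; normalisation to the origin `…CoreNormalise{Rescale,Transport,}`
p170404 p170475 p170530; cut-off and constants `…Step1Cutoff{,Pointwise,Constants,Bcut,Compact,Chain}`
p169882 p170211 p170453 p170526 p170631 p170786), Step 2 (Lemma 2.1: `…HmidiRousset` p156828,
`…CFZBounds` p158244, `…CutoffDivCurl{,Poloidal,SecondOrder}` p158842 p159232 p159652,
`…Lemma21Local{Identity,,Cutoff}` p161754 p162044 p162518; Lemma 2.2: `…LerayLogHardy` p154501),
Step 3 (`…Step13Tools` p156441, `…Step3{CutoffCalculus,Gamma,Balance,Integrated,SwirlSource,Absorb,StreamForm,SourcePhi,KeyEstimate,KeyUnconditional}`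
p162219 … p167165, local port `…Step3Local{Equations,EquationsPhi,Class,Balance,Integrated,Apriori,KeyEstimate0,Families,FamiliesW,Cutoff,KeyEstimate,KeyEstimateSZ}`
p170436 … p171742), Step 4 (`…VThetaPassage` p157337, `…Step4Assembly{Poloidal,Swirl,Parts,,KeyEstimate}`
p163258 p166696 p167315 p167532 p167718, `…Step4Endgame` p154978), and the bridges for the
cut-off globalisation `…CoreAtOriginBridges` (p171907).  This file closes it:

* `tendsto_cubicC_of_smooth_cleanConfig` — **Steps 1 + 3 + 4 for the Seregin–Zajaczkowski
  representative** (the class of the fact's core): clean configuration at `(0, 1)` + (2.2) for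
  `W` on `Q` off the axis + energy bound ⇒ `SereginSverak2009.cubicC 0 R W → 0` (`R → 0⁺`).
  The chain of `tendsto_cubicC_of_classical_cleanConfig` (`…Step1CutoffChain`) re-run verbatim
  for `v = χW` (`exists_cylCutoff`, `cutoffFamily_package`, radii
  `1 - 3δ/8 < 1 - δ/4 < 1 - δ/8 < 1`, so that the support box of the Step-1 cut-off `ζ` and the
  regular region `K` lie in `𝒞(1 - δ/4)` where `v = W`) with the LOCAL key estimate
  `cutoff_energy_keyEstimate_of_isSmoothAxisymmetricSolutionOn` in place of the classical one,
  the bridges being: (2.2) for `v` globally off the axis (`swirlBound_cutoffField`), the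
  derivative bounds of `W` on `K` transported to `v` (`derivBounds_of_eventuallyEq`), the energy
  bound and measurability (`energyBound_cutoffField`, `aestronglyMeasurable_cutoffField`), the
  gradient forms `‖∇f‖² = Σ(∂ᵢf)²` (`norm_fderiv_sq_eq_sum_sq`) in `hcut` and in the dissipation,
  the continuity of the dissipation densities from the uniform time moduli
  (`continuousOn_dissipation_cutoffField`), and `cubicC 0 R v = cubicC 0 R W` for `R ≤ 1 - δ/4`
  (`cubicC_cutoffField`);
* `isRegularAtOrigin_coreAtOrigin` — **the core at the origin holds**: the hypothesis of
  `seregin2022_logSwirl_regularAtOrigin_of_coreAtOrigin` (`…CoreNormalise`) verbatim, by the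
  endgame `isRegularAtOrigin_of_tendsto_cubicC` and `tendsto_cubicC_congr_ae` (`u = W` a.e.);
* `stub_sereginLogSwirlOrigin` (THE REGISTERED STUB) — by
  `seregin2022_logSwirl_regularAtOrigin_of_coreAtOrigin isRegularAtOrigin_coreAtOrigin`;
* `seregin2022_logSwirl_regularAtOrigin_holds` — the named Literature fact, discharged.

With the c1 capstone `Registered.AxisymmetricKatoGlobal_of_logSwirlFacts` the crux then rests,
along composition B of the skeleton, on `stub_swirlAxisModulus` alone.

## Mathlib / tree search

Tree: everything named above + `exists_step1_cutoff`, `exists_uniform_derivBounds`,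
`exists_cutoff_derivBounds`, `step3_pointwiseConstants`, `cut_bound`, `exists_radius_logSmall`,
`tendsto_cubicC_of_keyEstimate`, `smallness_of_logSmall`, `le_uniform_of_le`,
`le_uniform_div_of_le`, `parCyl_zero_one_eq_prod`, `mem_spaceCyl_zero_iff`, `spaceCyl_subset_box`.
Mathlib: `Ioc_mem_nhdsGT`, `Filter.Tendsto.congr'`.
`lean search 'seregin2022_logSwirl_regularAtOrigin_holds|tendsto_cubicC_of_smooth' --decl`:
no matches (2026-08-17); `lean find 'logSwirl'`, `lean find 'IsRegularAtOrigin'`: no stockroom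
matches.

## References

* G. Seregin, J. Math. Fluid Mech. 24 (2022), Paper No. 27 = arXiv:2201.00153, Thm. 1.2 and
  §2 proof, Steps 1–4 (arXiv pp. 5–7). [`Seregin2022LocalAxisym`]
* G. Seregin, W. Zajaczkowski, SIAM J. Math. Anal. 39 (2007) 669–685, Prop. 4.1 (the class).
  [`SereginZajaczkowski2007`]
* G. Seregin, V. Šverák, Comm. PDE 34 (2009) = arXiv:0804.1803, §3 (regular points).
  [`SereginSverak2009`]
-/

noncomputable section

open Set Filter Topology Function Metric MeasureTheory intervalIntegral
open scoped ENNReal NNReal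
open Literature.Analysis.FluidPDE Literature.Analysis.FluidPDE.SereginZajaczkowski2007

-- `<Problem> = <Summit>` duplicates a namespace component by design (lakefile sets the same option).
set_option linter.dupNamespace false

namespace Summit.NavierStokesRegularity.NavierStokesRegularity.Theorems.AxisymmetricKatoGlobal.EulerScaling

/-! ### The chain for the Seregin–Zajaczkowski representative -/

/-- **Seregin 2022, §2 Steps 1 + 3 + 4 at the normalised position `(0, 1)`, for the
Seregin–Zajaczkowski representative: the clean configuration implies `C(R) → 0`.** Let `(W, π)`
be in the class `IsSmoothAxisymmetricSolutionOn Q W π` on `Q = Q(0, 1) = 𝒞 × ]-1, 0[` (suitable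
weak solution with `C^∞` axisymmetric slices and jointly continuous spatial derivatives), with
the swirl bound (2.2) `|σ(W)(t, x)| ≤ C₁/ln³(e/ϱ(x))` on `Q` off the axis (`C₁ ≥ 0`) and the
energy bound `∫_𝒞 |W(t)|² ≤ A`, `t ∈ ]-1, 0[`. Assume the clean configuration at `(0, 1)`:
heights and width `h₋, h₊, δ` with `δ > 0`, `-1 ≤ h₋ - δ`, `h₋ + δ < 0 < h₊ - δ`, `h₊ + δ ≤ 1`,
and at every `a ∈ 𝒞` with `0 < ϱ(a) ∨ |a₃ - h₊| < δ ∨ |a₃ - h₋| < δ` a radius `ρ > 0` such that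
every `D_xⁿW` is bounded on `Q((0, a), ρ)`. Then `SereginSverak2009.cubicC 0 R W → 0` as
`R → 0⁺`. Proof: the chain of `tendsto_cubicC_of_classical_cleanConfig` run for the cut-off
globalisation `v = χW` (`χ = 1` on `𝒞(1 - δ/4)`, `tsupport χ ⊆ 𝒞(1 - δ/8)`): Step-1 cut-off
(radii `1/8 < 1/4`, support box inside `𝒞(1 - 3δ/8)`), smallness radius
(`exists_radius_logSmall 42 C₁`), compact regular region and uniform bounds, constants, the LOCAL
key estimate `cutoff_energy_keyEstimate_of_isSmoothAxisymmetricSolutionOn` (`ν = 1`, `ε = 1/4`)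
on `[t₁, t₂]` for every `t₂ < 0`, Step 4 (`tendsto_cubicC_of_keyEstimate`) for `v`, and
`C(R; v) = C(R; W)` for small `R`.
[cite: Seregin2022LocalAxisym, §2 Steps 1, 3, 4 (arXiv:2201.00153 pp. 5–7)] -/
theorem tendsto_cubicC_of_smooth_cleanConfig : ∀ (W : ℝ → EuclideanSpace ℝ (Fin 3) → EuclideanSpace ℝ (Fin 3)) (π : ℝ → EuclideanSpace ℝ (Fin 3) → ℝ) (hp hm δ C₁ : ℝ) (A : ℝ≥0), SereginZajaczkowski2007.IsSmoothAxisymmetricSolutionOn (SereginSverak2009.parCylOpens 0 1) W π → 0 < δ → -1 ≤ hm - δ → hm + δ < 0 → 0 < hp - δ → hp + δ ≤ 1 → 0 ≤ C₁ → (∀ z ∈ SereginSverak2009.parCyl (0 : ℝ × EuclideanSpace ℝ (Fin 3)) 1, 0 < cylRadius z.2 → |swirl (W z.1) z.2| ≤ C₁ / Real.log (Real.exp 1 / cylRadius z.2) ^ 3) → (∀ t ∈ Ioo (-1 : ℝ) 0, ∫⁻ x in SereginSverak2009.spaceCyl 0 1, ‖W t x‖ₑ ^ 2 ≤ A) → (∀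 a ∈ SereginSverak2009.spaceCyl (0 : EuclideanSpace ℝ (Fin 3)) 1, (0 < cylRadius a ∨ |a 2 - hp| < δ ∨ |a 2 - hm| < δ) → ∃ ρ > 0, ∀ n : ℕ, ∃ C : ℝ, ∀ w ∈ parabolicCylinder ρ ((0 : ℝ), a), ‖iteratedFDeriv ℝ n (W w.1) w.2‖ ≤ C) → Tendsto (fun R => SereginSverak2009.cubicC 0 R W) (𝓝[>] 0) (𝓝 0) := by
  -- adapted from `tendsto_cubicC_of_classical_cleanConfig`
  -- (Theorems/AxisymmetricExtremalityAxisymmetricKatoGlobalStubSereginLogSwirlOriginStep1CutoffChain.lean)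
  intro W π hp hm δ C₁ A hW hδ hm1 hm0 hp0 hp1 hC₁ hσ hA hcore
  -- Step 1 (a): the cut-off
  obtain ⟨ζ, hζC, hζax, hζc, hζ01, hplat, -, hts, hts1, hgradT, -⟩ :=
    exists_step1_cutoff (1 / 8) (1 / 4) hp hm δ (by norm_num) (by norm_num) (by norm_num) hδ hm1 hm0 hp0 hp1
  have hζ4 : ContDiff ℝ 4 ζ := hζC.of_le (by norm_cast)
  have hζ2 : ContDiff ℝ 2 ζ := hζC.of_le (by norm_cast)
  -- the globalisation `v = χW`: radii `ρa < ρb < ρc < 1`, support box of `ζ` inside `𝒞(ρa)`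
  have hδ2 : δ < 1 / 2 := by linarith
  set ρa : ℝ := 1 - 3 * δ / 8 with hρa
  set ρb : ℝ := 1 - δ / 4 with hρb
  set ρc : ℝ := 1 - δ / 8 with hρc
  have hρa0 : 0 < ρa := by rw [hρa]; linarith
  have hab : ρa < ρb := by rw [hρa, hρb]; linarith
  have hbc : ρb < ρc := by rw [hρb, hρc]; linarith
  have hc1 : ρc < 1 := by rw [hρc]; linarith
  have hmono : ∀ {r r' : ℝ}, r ≤ r' → SereginSverak2009.spaceCyl (0 : EuclideanSpace ℝ (Fin 3)) r ⊆
      SereginSverak2009.spaceCyl 0 r' := fun h y hy => by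
    rw [mem_spaceCyl_zero_iff] at hy ⊢; exact ⟨hy.1.trans_le h, hy.2.trans_le h⟩
  have hbox : {x : EuclideanSpace ℝ (Fin 3) | cylRadius x ≤ 1 / 4 ∧ hm - δ / 2 ≤ x 2 ∧ x 2 ≤ hp + δ / 2} ⊆
      SereginSverak2009.spaceCyl 0 ρa := by
    rintro x ⟨h1, h2, h3⟩
    rw [mem_spaceCyl_zero_iff, hρa]
    exact ⟨by linarith, abs_lt.2 ⟨by linarith, by linarith⟩⟩
  obtain ⟨χ, hχ, hχax, hχ01, hχ1, hχs⟩ := exists_cylCutoff (hρa0.trans hab) hbc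
  obtain ⟨v, hv⟩ : ∃ v : ℝ → EuclideanSpace ℝ (Fin 3) → EuclideanSpace ℝ (Fin 3), ∀ t, v t = fun y => χ y • W t y :=
    ⟨_, fun _ => rfl⟩
  have hsubS : Ioo (-1 : ℝ) 0 ×ˢ SereginSverak2009.spaceCyl (0 : EuclideanSpace ℝ (Fin 3)) 1 ⊆
      ((SereginSverak2009.parCylOpens 0 1 : TopologicalSpace.Opens (ℝ × EuclideanSpace ℝ (Fin 3))) :
        Set (ℝ × EuclideanSpace ℝ (Fin 3))) := by
    rw [SereginSverak2009.coe_parCylOpens, parCyl_zero_one_eq_prod]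
  obtain ⟨hsm, hax, hR2, hU, hloc, hdiv, -⟩ := cutoffFamily_package (SereginSverak2009.parCylOpens 0 1) W v π
    (Ioo (-1 : ℝ) 0) χ ρb ρc hW isOpen_Ioo hsubS (hρa0.trans hab) hbc hc1 hχ hχax hχ1 hχs hv
  have hχs1 : tsupport χ ⊆ SereginSverak2009.spaceCyl (0 : EuclideanSpace ℝ (Fin 3)) 1 := hχs.trans (hmono hc1.le)
  have hσv := swirlBound_cutoffField hv hχ01 hχs1 hC₁ hσ
  -- Step 3 (a): the smallness radius and `r₁`
  obtain ⟨rs, hrs, hsmallr⟩ := exists_radius_logSmall 42 C₁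
  set r₁ : ℝ := min rs (min (1 / 8) (min (hp - δ / 2) (-(hm + δ / 2)))) with hr₁def
  have hr₁pos : 0 < r₁ := lt_min hrs.1 (lt_min (by norm_num) (lt_min (by linarith) (by linarith)))
  have hr₁rs : r₁ ≤ rs := min_le_left _ _
  have hr₁8 : r₁ ≤ 1 / 8 := (min_le_right _ _).trans (min_le_left _ _)
  have hr₁p : r₁ ≤ hp - δ / 2 := (min_le_right _ _).trans ((min_le_right _ _).trans (min_le_left _ _))
  have hr₁m : r₁ ≤ -(hm + δ / 2) := (min_le_right _ _).trans ((min_le_right _ _).trans (min_le_right _ _))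
  have hr₁1 : r₁ < 1 := by linarith
  have hr₁b : r₁ ≤ ρb := by rw [hρb]; linarith
  have hL1 : 1 ≤ Real.log (Real.exp 1 / r₁) := one_le_log_exp_div hr₁pos hr₁1.le
  have hsmall : 8 * C₁ / Real.log (Real.exp 1 / r₁) + (13 * C₁ / Real.log (Real.exp 1 / r₁) ^ 2 + 4 * (1 / 4 : ℝ)) < 2 * 1 :=
    smallness_of_logSmall hC₁ hL1 (hsmallr r₁ ⟨hr₁pos, hr₁rs⟩)
  -- Step 1 (b): the compact regular region `K`
  set K : Set (EuclideanSpace ℝ (Fin 3)) :=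
    {x | cylRadius x ≤ 1 / 4 ∧ hm - δ / 2 ≤ x 2 ∧ x 2 ≤ hp + δ / 2 ∧
      ((1 / 8 : ℝ) ≤ cylRadius x ∨ |x 2 - hp| ≤ δ / 2 ∨ |x 2 - hm| ≤ δ / 2)} ∪
    ({x | cylRadius x ≤ 1 / 4 ∧ hm - δ / 2 ≤ x 2 ∧ x 2 ≤ hp + δ / 2} ∩ {x | r₁ ≤ cylRadius x}) with hKdef
  have hKbox : K ⊆ {x | cylRadius x ≤ 1 / 4 ∧ hm - δ / 2 ≤ x 2 ∧ x 2 ≤ hp + δ / 2} := by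
    rintro x (⟨h1, h2, h3, -⟩ | ⟨hx, -⟩)
    exacts [⟨h1, h2, h3⟩, hx]
  have hKc : IsCompact K :=
    (isCompact_box (by norm_num) hδ hm1 hp1).of_isClosed_subset
      ((isClosed_gradBox _ _ _ _ _ _ _).union ((isClosed_box _ _ _).inter
        (isClosed_le continuous_const continuous_cylRadius))) hKbox
  have hKgrad : tsupport (fderiv ℝ ζ) ⊆ K := fun x hx => Or.inl (hgradT hx)
  have hKfar : ∀ x ∈ tsupport ζ, r₁ ≤ cylRadius x → x ∈ K := fun x hx hr => Or.inr ⟨hts hx, hr⟩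
  have hKgood : ∀ a ∈ K, a ∈ SereginSverak2009.spaceCyl (0 : EuclideanSpace ℝ (Fin 3)) 1 ∧
      (0 < cylRadius a ∨ |a 2 - hp| < δ ∨ |a 2 - hm| < δ) := by
    intro a ha
    refine ⟨box_subset_spaceCyl (by norm_num) hδ hm1 hp1 (hKbox ha), ?_⟩
    rcases ha with ⟨-, -, -, h4⟩ | ⟨-, hr⟩
    · exact good_of_mem_gradBox (by norm_num) hδ h4
    · exact Or.inl (hr₁pos.trans_le hr)
  -- Step 1 (c): uniform bounds on `K` up to the top time, for `W` and then for `v = W` near `K`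
  obtain ⟨ρ, hρ, D₀, D₁, D₂, hD₀, hD₁, hD₂, hD⟩ := exists_uniform_derivBounds W K hKc
    fun a ha => hcore a (hKgood a ha).1 (hKgood a ha).2
  obtain ⟨Z₁, Z₂, Z₃, Q₀, Q₁, hZ₁0, hZ₂0, hZ₃0, hQ₀0, hQ₁0, hZ₁, hZ₂, hZ₃, hQ₀, hQ₁⟩ :=
    exists_cutoff_derivBounds hζ4 hζc hζax
  -- the final slab `]t₁, 0[`
  set ρ' : ℝ := min ρ 1 with hρ'
  have hρ'0 : 0 < ρ' := lt_min hρ one_pos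
  set t₁ : ℝ := -ρ' ^ 2 / 2 with ht₁def
  have ht₁0 : t₁ < 0 := by rw [ht₁def]; have := pow_pos hρ'0 2; linarith
  have ht₁1 : -1 < t₁ := by
    rw [ht₁def]
    have h1 : ρ' ^ 2 ≤ 1 := by
      have := pow_le_pow_left₀ hρ'0.le (min_le_right ρ 1) 2
      simpa using this
    linarith
  have ht₁ρ : -ρ ^ 2 < t₁ := by
    rw [ht₁def]
    have h1 : ρ' ^ 2 ≤ ρ ^ 2 := pow_le_pow_left₀ hρ'0.le (min_le_left ρ 1) 2
    have := pow_pos hρ'0 2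
    linarith
  have hslab : ∀ t, t₁ ≤ t → t < 0 → t ∈ Ioo (-1 : ℝ) 0 ∧ t ∈ Ioo (-ρ ^ 2) 0 := fun t h1 h2 =>
    ⟨⟨ht₁1.trans_le h1, h2⟩, ⟨ht₁ρ.trans_le h1, h2⟩⟩
  have hDv : ∀ t, t₁ ≤ t → t < 0 → ∀ x ∈ K,
      ‖v t x‖ ≤ D₀ ∧ ‖fderiv ℝ (v t) x‖ ≤ D₁ ∧ ‖iteratedFDeriv ℝ 2 (v t) x‖ ≤ D₂ := fun t h1 h2 x hx =>
    derivBounds_of_eventuallyEq (hloc t (hslab t h1 h2).1 x (hmono hab.le (hbox (hKbox hx))))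
      (hD t (hslab t h1 h2).2 x hx)
  -- regularity of the slices of `v`
  have hV4 : ∀ t ∈ Ioo (-1 : ℝ) 0, ContDiff ℝ 4 (v t) := fun t ht => (hsm t ht).of_le (by norm_cast)
  have hV3 : ∀ t ∈ Ioo (-1 : ℝ) 0, ContDiff ℝ 3 (v t) := fun t ht => (hV4 t ht).of_le (by norm_num)
  -- the constants
  set κ : ℝ := ‖curlCLM‖ with hκ
  set Vb : ℝ := volume.real (closedBall (0 : EuclideanSpace ℝ (Fin 3)) 2) with hVb
  have hVb0 : 0 ≤ Vb := measureReal_nonneg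
  set M : ℝ := D₁ * (κ * D₂) ^ 2 with hMdef
  set P₀ : ℝ := D₀ * D₁ * Z₁ + 4 * D₁ ^ 2 with hP₀def
  set P₁ : ℝ := D₁ * D₀ * Z₁ with hP₁def
  set P₂ : ℝ := κ * D₂ * Z₁ * (4 * D₁ ^ 2) with hP₂def
  set P₃ : ℝ := Z₁ * D₂ + Z₂ * D₁ + Q₀ * D₁ + Q₁ * D₀ with hP₃def
  set P₄ : ℝ := Z₁ * D₂ + 2 * Z₂ * D₁ + Z₃ * D₀ with hP₄def
  set Bcut : ℝ := 2 * ((2 * (Z₁ * D₀) + 2 * 1 * Z₁ ^ 2 + 4 * 1 * Q₀) * (κ * D₂) ^ 2 * Vb) with hBcutdef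
  have hκ0 : 0 ≤ κ := by rw [hκ]; exact norm_nonneg curlCLM
  have hM0 : 0 ≤ M := by positivity
  have hP₂0 : 0 ≤ P₂ := by positivity
  have hBcut0 : 0 ≤ Bcut := by positivity
  -- pointwise constants at every time of the slab
  have hpt : ∀ t, t₁ ≤ t → t < 0 → _ := fun t h1 h2 =>
    step3_pointwiseConstants (v t) ζ K r₁ D₀ D₁ D₂ Z₁ Z₂ Z₃ Q₀ Q₁ (hV3 t (hslab t h1 h2).1)
      (hax t (hslab t h1 h2).1) hζ4 hζax hζ01 hKgrad hKfar hD₀ hD₁ hD₂ hZ₁0 hZ₂0 hZ₃0 hQ₀0 hZ₁ hZ₂ hZ₃ hQ₀ hQ₁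
      (fun x hx => (hDv t h1 h2 x hx).1) (fun x hx => (hDv t h1 h2 x hx).2.1)
      (fun x hx => (hDv t h1 h2 x hx).2.2)
  have hcutt : ∀ t, t₁ ≤ t → t < 0 → _ := fun t h1 h2 =>
    cut_bound (v t) ζ K (-1) 0 1 t D₀ D₂ Z₁ Q₀ Vb (hV3 t (hslab t h1 h2).1) (hax t (hslab t h1 h2).1) hζ2
      hζax hζ01 hts1 hKgrad zero_le_one hD₀ hD₂ hZ₁0 hQ₀0 le_rfl hZ₁ hQ₀
      (fun x hx => (hDv t h1 h2 x hx).1) (fun x hx => (hDv t h1 h2 x hx).2.2)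
  -- the cut-off as a (time-independent) space-time function
  have hζst : IsSmoothSpaceTimeOn (Ioo (-1 : ℝ) 0) (fun _ : ℝ => ζ) := (hζC.comp contDiff_snd).contDiffOn
  -- Step 3: the LOCAL key estimate on `[t₁, t₂]`, every `t₂ ∈ ]t₁, 0[`
  have hkey : ∀ t₂ ∈ Ioo t₁ 0, _ := fun t₂ ht₂ =>
    cutoff_energy_keyEstimate_of_isSmoothAxisymmetricSolutionOn (SereginSverak2009.parCylOpens 0 1) W v π χ
      (fun _ : ℝ => ζ) (-1) 0 1 ρa ρb ρc t₁ t₂ C₁ r₁ M Bcut (1 / 4) P₀ P₁ P₂ P₃ P₄ Vb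
      hW hsubS rfl hρa0 hab hbc hc1 hχ hχax hχ1 hχs hv hζst (fun s _ => hζax) (fun s _ => hts.trans hbox)
      (fun t ht => (hslab t ht.1 (ht.2.trans_lt ht₂.2)).1) ht₂.1.le hC₁ hr₁pos hr₁1 hM0 hBcut0 (by norm_num) hP₂0 le_rfl
      (fun t ht x hx0 hxr => hσv t (hslab t ht.1 (ht.2.trans_lt ht₂.2)).1 x hx0 (hxr.trans hr₁1))
      (fun t ht => (hpt t ht.1 (ht.2.trans_lt ht₂.2)).1)
      (fun t ht => by
        have h := hcutt t ht.1 (ht.2.trans_lt ht₂.2)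
        simp only [← norm_fderiv_sq_eq_sum_sq] at h
        exact h)
      (fun t ht => (hpt t ht.1 (ht.2.trans_lt ht₂.2)).2.1)
      (fun t ht => (hpt t ht.1 (ht.2.trans_lt ht₂.2)).2.2.1)
      (fun t ht => (hpt t ht.1 (ht.2.trans_lt ht₂.2)).2.2.2.1)
      (fun t ht => (hpt t ht.1 (ht.2.trans_lt ht₂.2)).2.2.2.2.1)
      (fun t ht => (hpt t ht.1 (ht.2.trans_lt ht₂.2)).2.2.2.2.2.1)
      hsmall
  -- uniformity of the constants in `t₂`
  have hL0 : 0 < Real.log (Real.exp 1 / r₁) := zero_lt_one.trans_le hL1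
  have hSc0 : 0 ≤ Bcut + (12 * C₁ * (P₃ ^ 2 + P₄ ^ 2) * Vb / Real.log (Real.exp 1 / r₁) ^ 2 +
      ((P₀ ^ 2 + P₁ ^ 2) / (2 * (1 / 4 : ℝ)) + 2 * P₂) * Vb) + 4 * M * Vb := by positivity
  have hden0 : 0 < 2 * 1 - 8 * C₁ / Real.log (Real.exp 1 / r₁) -
      (13 * C₁ / Real.log (Real.exp 1 / r₁) ^ 2 + 4 * (1 / 4 : ℝ)) := by linarith only [hsmall]
  -- the dissipation in coordinate form
  have hkey2 : ∀ t₂ ∈ Ioo t₁ 0, ∫ s in t₁..t₂, ((∫ x, (fderiv ℝ (fun y => ζ y * angVortQuot (v s) y) x (EuclideanSpace.single 0 1) ^ 2 + fderiv ℝ (fun y => ζ y * angVortQuot (v s) y) x (EuclideanSpace.single 1 1) ^ 2 + fderiv ℝ (fun y => ζ y * angVortQuot (v s) y) x (EuclideanSpace.single 2 1) ^ 2)) + (∫ x, (fderiv ℝ (fun y => ζ y * radVelQuot (curl (v s)) y) x (EuclideanSpace.single 0 1) ^ 2 + fderiv ℝ (fun y => ζ y * radVelQuot (curl (v s)) y)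 x (EuclideanSpace.single 1 1) ^ 2 + fderiv ℝ (fun y => ζ y * radVelQuot (curl (v s)) y) x (EuclideanSpace.single 2 1) ^ 2))) ≤ _ := fun t₂ ht₂ => by
    have h := (hkey t₂ ht₂).2
    simp only [norm_fderiv_sq_eq_sum_sq] at h
    exact h
  -- Step 4 inputs: continuity in time of the dissipation densities
  have hIco : Ico t₁ 0 ⊆ Ioo (-1 : ℝ) 0 := fun t ht => ⟨ht₁1.trans_le ht.1, ht.2⟩
  obtain ⟨hDΓc, hDΦc⟩ := continuousOn_dissipation_cutoffField isOpen_Ioo hsm hR2 hU hζC hζc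
  -- Step 4 inputs: measurability, divergence, plateau, energy, bounds on `supp ∇ζ`
  have hmeas := aestronglyMeasurable_cutoffField hW hv hχ1 hr₁pos.le hr₁1.le hr₁b
  have hdiv' : ∀ t ∈ Ioo t₁ 0, ∀ x ∈ SereginSverak2009.spaceCyl (0 : EuclideanSpace ℝ (Fin 3)) ρb,
      VectorCalculus.divergence (v t) x = 0 := fun t ht x hx => hdiv t (hslab t ht.1.le ht.2).1 x hx
  have hζr₁ : ∀ x ∈ SereginSverak2009.spaceCyl (0 : EuclideanSpace ℝ (Fin 3)) r₁, ζ x = 1 := fun x hx => by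
    obtain ⟨h1, h2, h3⟩ := spaceCyl_subset_box hr₁8 hr₁p hr₁m hx
    exact hplat x h1 h2 h3
  have hLv : ∀ t ∈ Ioo t₁ 0, ∀ x, fderiv ℝ ζ x ≠ 0 → ‖v t x‖ ≤ D₀ := fun t ht x hx =>
    (hDv t ht.1.le ht.2 x (hKgrad (subset_tsupport _ (mem_support.2 hx)))).1
  -- Step 4 for `v`
  have hT := tendsto_cubicC_of_keyEstimate v ζ (SereginSverak2009.spaceCyl 0 ρb) t₁ r₁ D₀ _ _ A ht₁0 hr₁pos hr₁1.le
    hmeas (fun t ht => hV4 t (hslab t ht.1.le ht.2).1) (fun t ht => hax t (hslab t ht.1.le ht.2).1)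
    (SereginSverak2009.isOpen_spaceCyl 0 ρb) hdiv' hζ2 (hts.trans (hbox.trans (hmono hab.le))) hts1 hζr₁
    (fun t ht => energyBound_cutoffField hv hχ01 (hA t (hslab t ht.1.le ht.2).1)) hLv
    (fun t ht => le_uniform_of_le ((hkey t ht).1 t ⟨ht.1.le, le_rfl⟩) hSc0 ht.2.le) (hDΓc.mono hIco)
    (hDΦc.mono hIco) (fun t₂ ht₂ => le_uniform_div_of_le (hkey2 t₂ ht₂) hSc0 ht₂.2.le hden0)
  -- back to `W`: `C(R; v) = C(R; W)` for `0 < R ≤ ρb`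
  refine hT.congr' ?_
  filter_upwards [Ioc_mem_nhdsGT (hρa0.trans hab)] with R hR
  exact cubicC_cutoffField hv hχ1 hR.2

/-! ### The core at the origin -/

/-- **Seregin 2022, §2: the core of the criterion at the origin holds** — the hypothesis `hnorm`
of `seregin2022_logSwirl_regularAtOrigin_of_coreAtOrigin` (sibling `…CoreNormalise`), verbatim:
for `(u, π)` in the class (H) of the fact on `Q = 𝒞 × ]-1, 0[`, heights `h±` and width `δ`, a
representative `W` in `IsSmoothAxisymmetricSolutionOn Q W π` with `u = W` a.e. on `Q`, derivative
bounds up to the top time at the good top-slice points, (2.2) for `W` on `Q` off the axis and the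
energy bound for `W` at every time, the origin is a regular point of `u`:
`tendsto_cubicC_of_smooth_cleanConfig` gives `C(R; W) → 0`, `tendsto_cubicC_congr_ae` transports it
to `u`, and the landed endgame `isRegularAtOrigin_of_tendsto_cubicC` (Step 4, last sentence:
"According to the partial regularity theory … the origin is a regular point") concludes.
[cite: Seregin2022LocalAxisym, §2 proof of Thm. 1.2, Steps 1–4 (arXiv:2201.00153 pp. 5–7)] -/
theorem isRegularAtOrigin_coreAtOrigin : ∀ (u : ℝ → EuclideanSpace ℝ (Fin 3) → EuclideanSpace ℝ (Fin 3)) (π : ℝ → EuclideanSpace ℝ (Fin 3) → ℝ), IsSuitableWeakSolutionOn (SereginSverak2009.parCylOpens 0 1) 1 0 u π → (∃ C : ℝ≥0, ∀ᵐ s ∂(volume.restrict (Ioo (-1 : ℝ) 0)), ∫⁻ y in SereginSverak2009.spaceCyl 0 1, ‖u s y‖ₑ ^ 2 ≤ C) → (∃ G : ℝ → EuclideanSpace ℝ (Fin 3) → EuclideanSpace ℝ (Fin 3) →L[ℝ] EuclideanSpace ℝ (Fin 3), HasWeakSpatialGradientOn (SereginSverak2009.parCylOpens 0 1) u G ∧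 ∫⁻ z in SereginSverak2009.parCyl 0 1, ENNReal.ofReal (frobeniusNormSq (G z.1 z.2)) < ∞) → (∫⁻ z in SereginSverak2009.parCyl 0 1, ‖π z.1 z.2‖ₑ ^ (3 / 2 : ℝ) < ∞) → (∀ s ∈ Ioo (-1 : ℝ) 0, IsAxisymmetric (u s)) → (∀ s ∈ Ioo (-1 : ℝ) 0, IsAxisymmetricScalar (π s)) → (∃ C₁ : ℝ, 0 ≤ C₁ ∧ ∀ s ∈ Ioo (-1 : ℝ) 0, ∀ y ∈ SereginSverak2009.spaceCyl 0 1, 0 < cylRadius y → |swirl (u s) y| ≤ C₁ / Real.log (Real.exp 1 / cylRadius y) ^ 3) → ∀ (hp hm δ : ℝ) (W : ℝ → EuclideanSpace ℝ (Fin 3) → EuclideanSpace ℝ (Fin 3)), SereginZajaczkowski2007.IsSmoothAxisymmetricSolutionOn (SereginSverak2009.parCylOpens 0 1) W π → uncurry u =ᵐ[volume.restrict (SereginSverak2009.parCyl 0 1)] uncurry W → 0 < δ → -1 ≤ hm - δ → hm + δ < 0 → 0 < hp - δ → hp + δ ≤ 1 → (∀ a ∈ SereginSverak2009.spaceCyl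 (0 : EuclideanSpace ℝ (Fin 3)) 1, (0 < cylRadius a ∨ |a 2 - hp| < δ ∨ |a 2 - hm| < δ) → ∃ ρ > 0, parabolicCylinder ρ (((0 : ℝ), a) : ℝ × EuclideanSpace ℝ (Fin 3)) ⊆ SereginSverak2009.parCyl 0 1 ∧ ∀ n : ℕ, ∃ C : ℝ, ∀ w ∈ parabolicCylinder ρ (((0 : ℝ), a) : ℝ × EuclideanSpace ℝ (Fin 3)), ‖iteratedFDeriv ℝ n (W w.1) w.2‖ ≤ C) → (∃ C₁ : ℝ, 0 ≤ C₁ ∧ ∀ z ∈ SereginSverak2009.parCyl (0 : ℝ × EuclideanSpace ℝ (Fin 3)) 1, 0 < cylRadius z.2 → |swirl (W z.1) z.2| ≤ C₁ / Real.log (Real.exp 1 / cylRadius z.2) ^ 3) → (∃ A : ℝ≥0, ∀ s ∈ Ioo (-1 : ℝ) 0, ∫⁻ y in SereginSverak2009.spaceCyl 0 1, ‖W s y‖ₑ ^ 2 ≤ A) → SereginSverak2009.IsRegularAtOrigin u := by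
  rintro u π hsw hA hG hq - - - hp hm δ W hW hae hδ hm1 hm0 hp0 hp1 hcore ⟨C₁, hC₁, hσW⟩ ⟨A, hAW⟩
  refine isRegularAtOrigin_of_tendsto_cubicC u π hsw hA hG hq (tendsto_cubicC_congr_ae hae ?_)
  refine tendsto_cubicC_of_smooth_cleanConfig W π hp hm δ C₁ A hW hδ hm1 hm0 hp0 hp1 hC₁ hσW hAW fun a ha h => ?_
  obtain ⟨ρ, hρ, -, hb⟩ := hcore a ha h
  exact ⟨ρ, hρ, hb⟩

/-! ### The stub and the named fact -/

/-- **Stub 2a `stub_sereginLogSwirlOrigin` of the line `registered` of the crux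
`AxisymmetricKatoGlobal` = Seregin's logarithmic swirl criterion at the origin** (G. Seregin,
J. Math. Fluid Mech. 24 (2022), Paper 27 = arXiv:2201.00153, Thm. 1.2 via §2 Steps 1–4 from
(2.2)): let `(v, q)` be a suitable weak solution of the unit-viscosity Navier–Stokes system in
`Q = 𝒞 × ]-1, 0[` with `v ∈ L_{2,∞}(Q)`, `∇v ∈ L₂(Q)`, `q ∈ L_{3/2}(Q)` (Def. 1.1), axisymmetric
slices of `v` and `q`, and the swirl bound (2.2) `|σ(v(t))(x)| ≤ C₁/ln³(e/|x'|)` on `Q` off the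
axis; then the origin is a regular point of `v` (`SereginSverak2009.IsRegularAtOrigin`: `v` is
essentially bounded on some `Q(r)`). VERBATIM the named fact
`Literature.Analysis.FluidPDE.seregin2022_logSwirl_regularAtOrigin`; proof:
`seregin2022_logSwirl_regularAtOrigin_of_coreAtOrigin` (first singular time, top-time partial
regularity, clean slab and Seregin–Zajaczkowski representative, normalisation to the origin)
applied to `isRegularAtOrigin_coreAtOrigin` (Steps 1 + 3 + 4 for the representative and the
ε-regularity endgame). [cite: Seregin2022LocalAxisym, Thm. 1.2 / §2 proof, Steps 1–4 (arXiv:2201.00153 pp. 5–7)] -/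
theorem stub_sereginLogSwirlOrigin :
    ∀ (v : ℝ → EuclideanSpace ℝ (Fin 3) → EuclideanSpace ℝ (Fin 3)) (q : ℝ → EuclideanSpace ℝ (Fin 3) → ℝ),
      IsSuitableWeakSolutionOn (SereginSverak2009.parCylOpens 0 1) 1 0 v q →
      (∃ C : ℝ≥0, ∀ᵐ t ∂(volume.restrict (Ioo (-1 : ℝ) 0)),
          ∫⁻ x in SereginSverak2009.spaceCyl 0 1, ‖v t x‖ₑ ^ 2 ≤ C) →
      (∃ G : ℝ → EuclideanSpace ℝ (Fin 3) → EuclideanSpace ℝ (Fin 3) →L[ℝ] EuclideanSpace ℝ (Fin 3),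
          HasWeakSpatialGradientOn (SereginSverak2009.parCylOpens 0 1) v G ∧
          ∫⁻ z in SereginSverak2009.parCyl 0 1, ENNReal.ofReal (frobeniusNormSq (G z.1 z.2)) < ∞) →
      (∫⁻ z in SereginSverak2009.parCyl 0 1, ‖q z.1 z.2‖ₑ ^ (3 / 2 : ℝ) < ∞) →
      (∀ t ∈ Ioo (-1 : ℝ) 0, IsAxisymmetric (v t)) →
      (∀ t ∈ Ioo (-1 : ℝ) 0, IsAxisymmetricScalar (q t)) →
      (∃ C₁ : ℝ, ∀ t ∈ Ioo (-1 : ℝ) 0, ∀ x ∈ SereginSverak2009.spaceCyl 0 1, 0 < cylRadius x →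
          |swirl (v t) x| ≤ C₁ / Real.log (Real.exp 1 / cylRadius x) ^ 3) →
      SereginSverak2009.IsRegularAtOrigin v :=
  fun v q => seregin2022_logSwirl_regularAtOrigin_of_coreAtOrigin isRegularAtOrigin_coreAtOrigin v q

/-- **Seregin's logarithmic swirl criterion at the origin holds** (G. Seregin, J. Math. Fluid
Mech. 24 (2022), Paper 27 = arXiv:2201.00153, Thm. 1.2 via §2 from (2.2)): the named fact
`Literature.Analysis.FluidPDE.seregin2022_logSwirl_regularAtOrigin`, discharged by
`stub_sereginLogSwirlOrigin`. [cite: Seregin2022LocalAxisym, Thm. 1.2 / §2 proof, Steps 1–4 (arXiv:2201.00153 pp. 5–7)] -/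
theorem seregin2022_logSwirl_regularAtOrigin_holds :
    Literature.Analysis.FluidPDE.seregin2022_logSwirl_regularAtOrigin :=
  stub_sereginLogSwirlOrigin

end Summit.NavierStokesRegularity.NavierStokesRegularity.Theorems.AxisymmetricKatoGlobal.EulerScaling

end
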